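import Summits.SmoothPoincare4.SmoothPoincare4.Theorems.WeakReductionDescentLowGenusBase
import Literature.Barriers.SmoothPoincare4.LowGenusTrisectionsStandardOfClassification

/-!
# SmoothPoincare4 / WeakReductionDescent — `LowGenusBase` from the Meier–Schirmer–Zupan
# classification, at every universe (item stmt-SmoothPoincare4-17911, Part IV)

Support item `LowGenusBase` of route WeakReductionDescent (a smooth homotopy 4-sphere over the
Statement's bare binders with a Gay–Kirby trisection of genus `≤ 2` is `≅ S⁴`).  Parts I–III
(`WeakReductionDescentLowGenusBase.lean`, `…Leaves.lean`, `…Shield.lean`) show that the item is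
literally the tree's undischarged named fact
`Literature.Barriers.SmoothPoincare4.mz_genus_le_two_homotopySphere_gk` at universe `0`.

Since then the barrier catalogue consolidated its debt: the tree now vendors
Meier–Schirmer–Zupan's Theorem 1.2 itself,
`Literature.Topology.FourManifolds.msz_trisection_classification_gk`
(`LargeKTrisectionClassification.lean`), and proves
(`LowGenusTrisectionsStandardOfClassification.lean`, `WeaklyReducibleGenusThreeStandardProofs.lean`)
that the homotopy-sphere facts `msz_homotopySphere_gk`, `mz_genus_le_two_homotopySphere_gk`
follow from it and are universe-independent.  This file records the consequence for the item,
all proofs being composition of PROVED tree lemmas: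

* `LowGenusBase_iff_mz_univ` — the item is equivalent to `mz_genus_le_two_homotopySphere_gk.{u}`
  for EVERY universe `u` (not only `u = 0`): a discharge at any universe closes it.
* `LowGenusBase_of_msz_univ` — the item from `msz_homotopySphere_gk.{u}`, any `u`.
* `LowGenusBase_of_classification` — the item from the single consolidated debt node
  `msz_trisection_classification_gk.{u}`, any `u` (MSZ 2016, Thm. 1.2: a trisected closed
  oriented `X` with `k₀ ≥ g − 1` is `#^{k′}(S¹ × S³)` or has a `ℂP²` summand; a homotopy sphere
  among these is `S⁴`; for homotopy spheres `χ = 2` forces `g = Σ kᵢ`, so genus `≤ 2` is in range).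

Status: the item stays CONDITIONAL; the closing one-liner, the day the classification (or either
homotopy-sphere fact) is discharged at some universe, is
`theorem LowGenusBase_proof : LowGenusBase := LowGenusBase_of_classification ‹_›`
(resp. `LowGenusBase_iff_mz_univ.2 ‹_›`, `LowGenusBase_of_msz_univ ‹_›`).

References: [MeierSchirmerZupan2016] arXiv:1507.06561 Thm. 1.2, Cor. 1.3, Remark 3.12 ·
[MeierZupan2017] arXiv:1410.8133 Thm. 1.3 · [GayKirby2016] Def. 1, Remark 2.
-/

-- the registered namespace `Summit.SmoothPoincare4.SmoothPoincare4.Theorems` repeats a component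
set_option linter.dupNamespace false

noncomputable section

namespace Summit.SmoothPoincare4.SmoothPoincare4.Theorems

universe u

open Summit.SmoothPoincare4.SmoothPoincare4.Theses.WeakReductionDescent

/-- **The route item `LowGenusBase` is the Meier–Zupan / MSZ homotopy-sphere fact
`mz_genus_le_two_homotopySphere_gk` at EVERY universe `u`** (Part I gave `u = 0`; the fact is
universe-independent by the tree's proved transport along `Shrink`,
`mz_genus_le_two_homotopySphere_gk_of_univ`).  So a discharge of the fact at any one universe
closes the item, and conversely. [cite: MeierZupan2017, Thm. 1.2 (arXiv Thm. 1.3)]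
[cite: MeierSchirmerZupan2016, Thm. 1.2 and Remark 3.12] -/
theorem LowGenusBase_iff_mz_univ :
    Summit.SmoothPoincare4.SmoothPoincare4.Theses.WeakReductionDescent.LowGenusBase ↔
      Literature.Barriers.SmoothPoincare4.mz_genus_le_two_homotopySphere_gk.{u} :=
  LowGenusBase_iff_mz.trans
    ⟨Literature.Barriers.SmoothPoincare4.mz_genus_le_two_homotopySphere_gk_of_univ,
      Literature.Barriers.SmoothPoincare4.mz_genus_le_two_homotopySphere_gk_of_univ⟩

/-- **`LowGenusBase` from Meier–Schirmer–Zupan's homotopy-sphere fact at any universe**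
(`msz_homotopySphere_gk.{u}`: a trisected closed oriented homotopy 4-sphere with some
`kᵢ ≥ g − 1` is `≅ S⁴`), through the tree's proved universe transport and Euler-characteristic
reduction.  CONDITIONAL on the named fact `h`.
[cite: MeierSchirmerZupan2016, Thm. 1.2 and Remark 3.12] [cite: GayKirby2016, Remark 2] -/
theorem LowGenusBase_of_msz_univ
    (h : Literature.Barriers.SmoothPoincare4.msz_homotopySphere_gk.{u}) :
    Summit.SmoothPoincare4.SmoothPoincare4.Theses.WeakReductionDescent.LowGenusBase :=
  LowGenusBase_of_msz (Literature.Barriers.SmoothPoincare4.msz_homotopySphere_gk_of_univ h)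

/-- **`LowGenusBase` from the Meier–Schirmer–Zupan classification (Thm. 1.2) at any universe** —
the single consolidated debt node `msz_trisection_classification_gk` of the barrier catalogue:
a closed connected oriented trisected `X` with `k₀ ≥ g − 1` is `#^{k′}(S¹ × S³)` or a connected
sum `M # ℂP²`; a homotopy 4-sphere has no `ℂP²` summand and `#^{k′}(S¹ × S³)` is simply
connected only for `k′ = 0`, so it is `S⁴`
(`mz_genus_le_two_homotopySphere_gk_of_classification`, PROVED in the tree); for homotopy spheres
`χ = 2` forces `g = k₀ + k₁ + k₂`, so every genus-`≤ 2` trisection is in the range of the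
theorem.  CONDITIONAL on the named fact `h`; the closing one-liner of the item once `h` is
discharged is `LowGenusBase_of_classification ‹_›`.
[cite: MeierSchirmerZupan2016, Thm. 1.2 and Cor. 1.3] [cite: MeierZupan2017, Thm. 1.2 (arXiv Thm. 1.3)] -/
theorem LowGenusBase_of_classification
    (h : Literature.Topology.FourManifolds.msz_trisection_classification_gk.{u}) :
    Summit.SmoothPoincare4.SmoothPoincare4.Theses.WeakReductionDescent.LowGenusBase :=
  LowGenusBase_of_mz
    (Literature.Barriers.SmoothPoincare4.mz_genus_le_two_homotopySphere_gk_of_classification h)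

end Summit.SmoothPoincare4.SmoothPoincare4.Theorems

end
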